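import Summits.BirchSwinnertonDyer.BirchSwinnertonDyer.Theses.ShaPrimaryTransfer
import Literature.NumberTheory.EllipticCurves.XCubeAddDXSharpRankSha
import Literature.NumberTheory.EllipticCurves.XCubeSub82XRankThree

/-!
# BirchSwinnertonDyer / ShaPrimaryTransfer — crux `FiniteShaComponentTransfer` (stmt-BirchSwinnertonDyer-22356):
# the door at 2 is open in the kernel at RANK 7 — `E : y² = x³ − 253160002x` has `rank E(ℚ) = 7` and `Ш(E/ℚ)[2] = 0`

Route `ShaPrimaryTransfer` (D-0145 LINE 2): T = `FiniteShaComponentTransfer` (stmt-22356), whose door at `2` is decided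
curve by curve by complete `2`-descent; companions certify the door in the kernel at ranks `0–3`, `5`, `6`. This helper file
(prover seat `bsd-line-spt-p1` g5, `--supports stmt-22356 --as helper`) reaches RANK 7 with the same instrument and no other
input: `E : y² = x³ − 253160002x` (`253160002 = 2·113·593·1889`), `E' : y² = x³ + 1012640008x`. The descent via `2`-isogeny
is SHARP on both sides: on `E` the points `(−9, 47733)`, `(−8/9, 405028/27)`, `(−2825, 832245)`, `(−71753/9, 33195547/27)` and
`T` give `α = [−1], [−2], [−113], [−593], [−253160002]`; on `E'` the points `(200, 450040)`, `(40793, 10449449)`, `(593, 775051)`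
and `T'` give `ᾱ = [2], [113], [593], [253160002]`. Since `#α · #ᾱ = 2^{rank+2}` (Silverman–Tate, tree
`natCard_range_xSqClass_mul`) both cardinalities are powers of `2`, so `#α ≥ 17 ⇒ #α ≥ 32` and `#ᾱ ≥ 9 ⇒ #ᾱ ≥ 16`
(we exhibit `17`, resp. `9`, distinct classes), whence `2^{rank+2} ≥ 2⁹`; and `rank ≤ ν(n) + ν(2n) − 1 = 4 + 4 − 1 = 7`
(X.6.1(b) sharpened, tree `XCubeAddDX.mordellWeilRank_le_add`): **`rank E(ℚ) = 7`** (`mordellWeilRank_eq_seven`). The bound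
being attained, both `φ`-parts of `Ш` vanish (tree `forall_mem_sha_two_smul_eq_zero_xD_of_rank_eq`, X.4.7):
**`Ш(E/ℚ)[2] = 0`** (`forall_mem_sha_two_smul_eq_zero`), `t_2(E) = 0` (`door_at_two_rank_seven`), `corank_{ℤ_2} Sel_{2^∞}(E/ℚ)
= 7` (`selmerCorank_two_eq_seven`), O for `E` (`oneFiniteShaComponent_E`); T BY NAME: `selmerCorank_eq_seven_of_transfer`
(granting T, `t_q(E) = 0` and `corank Sel_{q^∞}(E) = 7` at every prime `q`).

Everything is UNCONDITIONAL (standard axioms; no named fact, no `L`-function, no local insolubility argument — the curve was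
selected by a seconds-long search among `y² = x³ − 2p₁p₂p₃x`, `pᵢ ≡ 1 (mod 8)` pairwise quadratic residues, for rational
points filling the a-priori Selmer bounds). In this tree exact ranks had been certified up to `4` (`CongruentNumberCurve29274Selmer`;
`rankFiveWitness`: `5 ≤ rank`). Nothing here proves T, O or BSD; T is conjecture-grade at rank ≥ 2 and its CONCLUSION (all
`t_q = 0`) is certified for no curve of rank ≥ 2. (`E` has CM by `ℤ[i]`.) References: J. H. Silverman, *AEC* 2nd ed., X.4.7,
X.4.9, X.6.1; J. H. Silverman, J. Tate, *Rational Points on Elliptic Curves*, §3.5–3.6; R. Greenberg, LNM 1716 (1999), §1.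
-/

-- D-0017: single-problem summit, so `Summit.BirchSwinnertonDyer.BirchSwinnertonDyer.…` repeats a namespace BY DESIGN.
set_option linter.dupNamespace false

noncomputable section

namespace Summit.BirchSwinnertonDyer.BirchSwinnertonDyer.Theorems.ShaPrimaryTransferKernelRankSeven

open scoped Classical
open Literature.NumberTheory.EllipticCurves Literature.NumberTheory.EllipticCurves.XCubeAddDX
open WeierstrassCurve WeierstrassCurve.Affine
open Summit.BirchSwinnertonDyer.BirchSwinnertonDyer.Theses.ShaPrimaryTransfer (FiniteShaComponentTransfer)

/-! ## §0 Bookkeeping (`n = 253160002 = 2·113·593·1889`, `4n = 1012640008`) -/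

/-- `b(a² − 4b) ≠ 0` for `(a, b) = (0, −253160002)`. [folklore] -/
private theorem hab7 : (-253160002 : ℤ) * ((0 : ℤ) ^ 2 - 4 * (-253160002)) ≠ 0 := by norm_num

/-- The tree's literal `E_{0,−n}` is `⟨0, 0, 0, −n, 0⟩`. [folklore] -/
private theorem lit_E : (⟨0, ((0 : ℤ) : ℚ), 0, ((-253160002 : ℤ) : ℚ), 0⟩ : WeierstrassCurve ℚ) = ⟨0, 0, 0, -253160002, 0⟩ := by
  ext <;> push_cast <;> ring

/-- The literal `⟨0, 0, 0, ((−n : ℤ) : ℚ), 0⟩` is `⟨0, 0, 0, −n, 0⟩`. [folklore] -/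
private theorem lit_E₀ : (⟨0, 0, 0, ((-253160002 : ℤ) : ℚ), 0⟩ : WeierstrassCurve ℚ) = ⟨0, 0, 0, -253160002, 0⟩ := by
  ext <;> push_cast <;> ring

/-- The tree's literal `E'_{0,−n} = E_{0, 4n}` is `⟨0, 0, 0, 1012640008, 0⟩`. [folklore] -/
private theorem lit_E' :
    (⟨0, ((-2 * 0 : ℤ) : ℚ), 0, (((0 : ℤ) ^ 2 - 4 * (-253160002) : ℤ) : ℚ), 0⟩ : WeierstrassCurve ℚ) =
      ⟨0, 0, 0, 1012640008, 0⟩ := by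
  ext <;> push_cast <;> ring

/-- `E : y² = x³ − 253160002x` is an elliptic curve. [folklore] -/
theorem isElliptic_E : (⟨0, 0, 0, -253160002, 0⟩ : WeierstrassCurve ℚ).IsElliptic := by
  rw [← lit_E]; exact isElliptic_mk_of_ne_zero (F := ℚ) hab7

/-- `E' : y² = x³ + 1012640008x` is an elliptic curve. [folklore] -/
theorem isElliptic_E' : (⟨0, 0, 0, 1012640008, 0⟩ : WeierstrassCurve ℚ).IsElliptic := by
  rw [← lit_E']; exact isElliptic_mk_of_ne_zero (F := ℚ) (twoIsogenyCodomain_ne_zero hab7)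

/-- Squarefree integers with the same class in `ℚ*/ℚ*²` are equal. [folklore] -/
private theorem eq_of_sqClass_intCast_eq {d₁ d₂ : ℤ} (h₁ : Squarefree d₁) (h₂ : Squarefree d₂)
    (he : sqClass (d₁ : ℚ) = sqClass (d₂ : ℚ)) : d₁ = d₂ := by
  have h0₁ : (d₁ : ℚ) ≠ 0 := by exact_mod_cast h₁.ne_zero
  have h0₂ : (d₂ : ℚ) ≠ 0 := by exact_mod_cast h₂.ne_zero
  have h1 : sqClass ((d₁ : ℚ) * d₂) = 1 := by rw [sqClass_mul h0₁ h0₂, he, SqUnits.mul_self]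
  obtain ⟨u, hu⟩ := (sqClass_eq_one_iff (mul_ne_zero h0₁ h0₂)).mp h1
  obtain ⟨m, hm⟩ : IsSquare (d₁ * d₂) := by
    rw [← Rat.isSquare_intCast_iff]
    exact ⟨u, by push_cast; rw [hu, pow_two]⟩
  exact eq_of_squarefree_of_mul_eq_sq h₁ h₂ (m := m) (by rw [hm, pow_two])

/-- Squarefreeness of an integer from the factorisation of its absolute value. [folklore] -/
private theorem squarefree_int_of_natAbs {d : ℤ} {n : ℕ} (h : d.natAbs = n) (hn : n ≠ 0)
    (hnd : n.primeFactorsList.Nodup) : Squarefree d :=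
  Int.squarefree_natAbs.mp (h ▸ (Nat.squarefree_iff_nodup_primeFactorsList hn).mpr hnd)

/-- `−d` is squarefree with `d`. [folklore] -/
private theorem squarefree_neg_iff {d : ℤ} : Squarefree (-d) ↔ Squarefree d := by
  rw [← Int.squarefree_natAbs, Int.natAbs_neg, Int.squarefree_natAbs]

/-- The squarefree divisors `1, 2, 113, 226, 593, 1186, 67009, 134018, 253160002` of `n`. [folklore] -/
private theorem squarefree_of_mem {d : ℤ}
    (hd : d ∈ ({1, 2, 113, 226, 593, 1186, 67009, 134018, 253160002} : Finset ℤ)) : Squarefree d := by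
  simp only [Finset.mem_insert, Finset.mem_singleton] at hd
  rcases hd with rfl | rfl | rfl | rfl | rfl | rfl | rfl | rfl | rfl
  · exact squarefree_int_of_natAbs (n := 1) rfl one_ne_zero (by simp)
  · exact squarefree_int_of_natAbs (n := 2) rfl two_ne_zero (by simp)
  · exact squarefree_int_of_natAbs (n := 113) rfl (by norm_num) (by simp)
  · exact squarefree_int_of_natAbs (n := 226) rfl (by norm_num) (by simp)
  · exact squarefree_int_of_natAbs (n := 593) rfl (by norm_num) (by simp)
  · exact squarefree_int_of_natAbs (n := 1186) rfl (by norm_num) (by simp)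
  · exact squarefree_int_of_natAbs (n := 67009) rfl (by norm_num) (by simp)
  · exact squarefree_int_of_natAbs (n := 134018) rfl (by norm_num) (by simp)
  · exact squarefree_int_of_natAbs (n := 253160002) rfl (by norm_num) (by simp)

/-- A rational solution of `y² = x³ + bx` with `x ≠ 0` puts `[x]` into `α(E_{0,b}(ℚ))`. [folklore] -/
private theorem sqClass_mem_range_of_eq {b x y : ℚ} [(⟨0, 0, 0, b, 0⟩ : WeierstrassCurve ℚ).IsElliptic]
    (hy : y ^ 2 = x ^ 3 + b * x) (hx : x ≠ 0) : sqClass x ∈ Set.range (⟨0, 0, 0, b, 0⟩ : WeierstrassCurve ℚ).xSqClass := by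
  have hns : (⟨0, 0, 0, b, 0⟩ : WeierstrassCurve ℚ).toAffine.Nonsingular x y := by
    refine Affine.equation_iff_nonsingular.mp ?_
    rw [Affine.equation_iff]
    show y ^ 2 + 0 * x * y + 0 * y = x ^ 3 + 0 * x ^ 2 + b * x + 0
    linear_combination hy
  exact ⟨.some x y hns, xSqClass_some_of_ne_zero _ hx⟩

/-- `[x t²] = [x]` in `ℚ*/ℚ*²`. [folklore] -/
private theorem sqClass_mul_sq' {x t : ℚ} (hx : x ≠ 0) (ht : t ≠ 0) : sqClass (x * t ^ 2) = sqClass x := by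
  rw [sqClass_mul hx (pow_ne_zero 2 ht), sqClass_sq, mul_one]

/-- A natural number that is a power of `2` and at least `2^{k−1} + 1` is at least `2^k` (used with `k = 5, 4`). [folklore] -/
private theorem pow_two_le_of_lt {m j k : ℕ} (hm : m = 2 ^ j) (hlt : 2 ^ (k - 1) < m) (hk : 1 ≤ k) : 2 ^ k ≤ m := by
  subst hm
  have hj : k - 1 < j := (Nat.pow_lt_pow_iff_right Nat.one_lt_two).mp hlt
  exact Nat.pow_le_pow_right two_pos (by omega)

/-! ## §1 `#α(E(ℚ)) ≥ 17` (hence `= 32`): the points `(−9, 47733)`, `(−8/9, 405028/27)`, `(−2825, 832245)`, `(−71753/9, 33195547/27)` -/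

/-- **`#α(E(ℚ)) ≥ 17` for `E : y² = x³ − 253160002x`**: the rational points `(−9, 47733)`, `(−8/9, 405028/27)`,
`(−2825, 832245)` (`= −113·5²`), `(−71753/9, 33195547/27)` (`= −593·(11/3)²`) give `α = [−1], [−2], [−113], [−593]`, and
`α(T) = [−253160002]`; with products, seventeen distinct classes lie in `α(E(ℚ))` (in fact all `32`). UNCONDITIONAL.
[cite: SilvermanTate2015, §3.5–3.6 (α(x,y) = x mod ℚ*²; 2^r = #α(Γ)·#ᾱ(Γ̄)/4)] -/
theorem natCard_range_xSqClass_E_ge :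
    (Set.range (⟨0, 0, 0, -253160002, 0⟩ : WeierstrassCurve ℚ).xSqClass).Finite ∧
      17 ≤ Nat.card (Set.range (⟨0, 0, 0, -253160002, 0⟩ : WeierstrassCurve ℚ).xSqClass) := by
  haveI := isElliptic_E
  set W := (⟨0, 0, 0, -253160002, 0⟩ : WeierstrassCurve ℚ) with hW
  have hfin : (Set.range W.xSqClass).Finite := by
    have h := (natCard_range_xSqClass_le (a := 0) (b := -253160002) hab7).1
    rw [lit_E] at h
    exact h
  refine ⟨hfin, ?_⟩
  have mul : ∀ {x y : ℚ}, x ≠ 0 → y ≠ 0 → sqClass x ∈ Set.range W.xSqClass → sqClass y ∈ Set.range W.xSqClass →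
      sqClass (x * y) ∈ Set.range W.xSqClass := by
    intro x y hx hy h₁ h₂
    rw [sqClass_mul hx hy]
    exact mul_mem_range_xSqClass W h₁ h₂
  have g0 : sqClass (1 : ℚ) ∈ Set.range W.xSqClass :=
    ⟨0, by rw [xSqClass_zero]; exact ((sqClass_eq_one_iff one_ne_zero).mpr ⟨1, by norm_num⟩).symm⟩
  have gm1 : sqClass (-1 : ℚ) ∈ Set.range W.xSqClass := by
    have h := sqClass_mem_range_of_eq (b := -253160002) (x := -9) (y := 47733) (by norm_num) (by norm_num)
    rwa [show (-9 : ℚ) = -1 * 3 ^ 2 by norm_num, sqClass_mul_sq' (by norm_num) (by norm_num)] at h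
  have gm2 : sqClass (-2 : ℚ) ∈ Set.range W.xSqClass := by
    have h := sqClass_mem_range_of_eq (b := -253160002) (x := -8 / 9) (y := 405028 / 27) (by norm_num) (by norm_num)
    rwa [show (-8 / 9 : ℚ) = -2 * (2 / 3) ^ 2 by norm_num, sqClass_mul_sq' (by norm_num) (by norm_num)] at h
  have gm113 : sqClass (-113 : ℚ) ∈ Set.range W.xSqClass := by
    have h := sqClass_mem_range_of_eq (b := -253160002) (x := -2825) (y := 832245) (by norm_num) (by norm_num)
    rwa [show (-2825 : ℚ) = -113 * 5 ^ 2 by norm_num, sqClass_mul_sq' (by norm_num) (by norm_num)] at h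
  have gm593 : sqClass (-593 : ℚ) ∈ Set.range W.xSqClass := by
    have h := sqClass_mem_range_of_eq (b := -253160002) (x := -71753 / 9) (y := 33195547 / 27) (by norm_num) (by norm_num)
    rwa [show (-71753 / 9 : ℚ) = -593 * (11 / 3) ^ 2 by norm_num, sqClass_mul_sq' (by norm_num) (by norm_num)] at h
  have gT : sqClass (-253160002 : ℚ) ∈ Set.range W.xSqClass := ⟨W.twoTorsionPoint, by rw [xSqClass_twoTorsionPoint]⟩
  have neg : ∀ {x : ℚ}, x ≠ 0 → sqClass x ∈ Set.range W.xSqClass → sqClass (-x) ∈ Set.range W.xSqClass := by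
    intro x hx h
    have h' := mul (by norm_num) hx gm1 h
    rwa [neg_one_mul] at h'
  have g2 : sqClass (2 : ℚ) ∈ Set.range W.xSqClass := by
    have h := neg (by norm_num) gm2; norm_num at h; exact h
  have g113 : sqClass (113 : ℚ) ∈ Set.range W.xSqClass := by
    have h := neg (by norm_num) gm113; norm_num at h; exact h
  have g593 : sqClass (593 : ℚ) ∈ Set.range W.xSqClass := by
    have h := neg (by norm_num) gm593; norm_num at h; exact h
  have g226 : sqClass (226 : ℚ) ∈ Set.range W.xSqClass := by
    have h := mul (by norm_num) (by norm_num) g2 g113; norm_num at h; exact h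
  have g1186 : sqClass (1186 : ℚ) ∈ Set.range W.xSqClass := by
    have h := mul (by norm_num) (by norm_num) g2 g593; norm_num at h; exact h
  have g67009 : sqClass (67009 : ℚ) ∈ Set.range W.xSqClass := by
    have h := mul (by norm_num) (by norm_num) g113 g593; norm_num at h; exact h
  have g134018 : sqClass (134018 : ℚ) ∈ Set.range W.xSqClass := by
    have h := mul (by norm_num) (by norm_num) g2 g67009; norm_num at h; exact h
  set C : Finset ℤ := {1, -1, 2, -2, 113, -113, 226, -226, 593, -593, 1186, -1186, 67009, -67009, 134018, -134018,
    -253160002} with hC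
  have hsqf : ∀ d ∈ C, Squarefree d := by
    intro d hd
    simp only [hC, Finset.mem_insert, Finset.mem_singleton] at hd
    rcases hd with rfl | rfl | rfl | rfl | rfl | rfl | rfl | rfl | rfl | rfl | rfl | rfl | rfl | rfl | rfl | rfl | rfl
    · exact squarefree_of_mem (by simp)
    · exact squarefree_neg_iff.mpr (squarefree_of_mem (by simp))
    · exact squarefree_of_mem (by simp)
    · exact squarefree_neg_iff.mpr (squarefree_of_mem (by simp))
    · exact squarefree_of_mem (by simp)
    · exact squarefree_neg_iff.mpr (squarefree_of_mem (by simp))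
    · exact squarefree_of_mem (by simp)
    · exact squarefree_neg_iff.mpr (squarefree_of_mem (by simp))
    · exact squarefree_of_mem (by simp)
    · exact squarefree_neg_iff.mpr (squarefree_of_mem (by simp))
    · exact squarefree_of_mem (by simp)
    · exact squarefree_neg_iff.mpr (squarefree_of_mem (by simp))
    · exact squarefree_of_mem (by simp)
    · exact squarefree_neg_iff.mpr (squarefree_of_mem (by simp))
    · exact squarefree_of_mem (by simp)
    · exact squarefree_neg_iff.mpr (squarefree_of_mem (by simp))
    · exact squarefree_neg_iff.mpr (squarefree_of_mem (by simp))
  have hsub : (↑(C.image fun d : ℤ => sqClass (d : ℚ)) : Set (SqUnits ℚ)) ⊆ Set.range W.xSqClass := by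
    intro c hc
    obtain ⟨d, hd, rfl⟩ := Finset.mem_image.mp (Finset.mem_coe.mp hc)
    simp only [hC, Finset.mem_insert, Finset.mem_singleton] at hd
    rcases hd with rfl | rfl | rfl | rfl | rfl | rfl | rfl | rfl | rfl | rfl | rfl | rfl | rfl | rfl | rfl | rfl | rfl <;>
      push_cast
    · exact g0
    · exact gm1
    · exact g2
    · exact gm2
    · exact g113
    · exact gm113
    · exact g226
    · exact neg (by norm_num) g226
    · exact g593
    · exact gm593
    · exact g1186
    · exact neg (by norm_num) g1186
    · exact g67009
    · exact neg (by norm_num) g67009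
    · exact g134018
    · exact neg (by norm_num) g134018
    · exact gT
  have hcard : (C.image fun d : ℤ => sqClass (d : ℚ)).card = 17 := by
    rw [Finset.card_image_of_injOn (fun d₁ h₁ d₂ h₂ he => eq_of_sqClass_intCast_eq (hsqf d₁ h₁) (hsqf d₂ h₂) he)]
    rfl
  calc 17 = (↑(C.image fun d : ℤ => sqClass (d : ℚ)) : Set (SqUnits ℚ)).ncard := by rw [Set.ncard_coe_finset, hcard]
    _ ≤ (Set.range W.xSqClass).ncard := Set.ncard_le_ncard hsub hfin
    _ = Nat.card (Set.range W.xSqClass) := (Nat.card_coe_set_eq _).symm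

/-! ## §2 `#ᾱ(E'(ℚ)) ≥ 9` (hence `= 16`): the points `(200, 450040)`, `(40793, 10449449)`, `(593, 775051)` and `T'` -/

/-- **`#ᾱ(E'(ℚ)) ≥ 9` for `E' : y² = x³ + 1012640008x`**: `ᾱ(200, 450040) = [2]`, `ᾱ(40793, 10449449) = [113]`
(`40793 = 113·19²`), `ᾱ(593, 775051) = [593]`, `ᾱ(T') = [1012640008] = [253160002]`; with products, nine distinct classes
(in fact all `16` positive ones). UNCONDITIONAL. [cite: SilvermanTate2015, §3.5–3.6 (ᾱ on Γ̄)] -/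
theorem natCard_range_xSqClass_E'_ge :
    (Set.range (⟨0, 0, 0, 1012640008, 0⟩ : WeierstrassCurve ℚ).xSqClass).Finite ∧
      9 ≤ Nat.card (Set.range (⟨0, 0, 0, 1012640008, 0⟩ : WeierstrassCurve ℚ).xSqClass) := by
  haveI := isElliptic_E'
  set W := (⟨0, 0, 0, 1012640008, 0⟩ : WeierstrassCurve ℚ) with hW
  have hfin : (Set.range W.xSqClass).Finite := by
    have h := (natCard_range_xSqClass_le (a := -2 * 0) (b := (0 : ℤ) ^ 2 - 4 * (-253160002))
      (twoIsogenyCodomain_ne_zero hab7)).1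
    rw [lit_E'] at h
    exact h
  refine ⟨hfin, ?_⟩
  have mul : ∀ {x y : ℚ}, x ≠ 0 → y ≠ 0 → sqClass x ∈ Set.range W.xSqClass → sqClass y ∈ Set.range W.xSqClass →
      sqClass (x * y) ∈ Set.range W.xSqClass := by
    intro x y hx hy h₁ h₂
    rw [sqClass_mul hx hy]
    exact mul_mem_range_xSqClass W h₁ h₂
  have g0 : sqClass (1 : ℚ) ∈ Set.range W.xSqClass :=
    ⟨0, by rw [xSqClass_zero]; exact ((sqClass_eq_one_iff one_ne_zero).mpr ⟨1, by norm_num⟩).symm⟩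
  have g2 : sqClass (2 : ℚ) ∈ Set.range W.xSqClass := by
    have h := sqClass_mem_range_of_eq (b := 1012640008) (x := 200) (y := 450040) (by norm_num) (by norm_num)
    rwa [show (200 : ℚ) = 2 * 10 ^ 2 by norm_num, sqClass_mul_sq' (by norm_num) (by norm_num)] at h
  have g113 : sqClass (113 : ℚ) ∈ Set.range W.xSqClass := by
    have h := sqClass_mem_range_of_eq (b := 1012640008) (x := 40793) (y := 10449449) (by norm_num) (by norm_num)
    rwa [show (40793 : ℚ) = 113 * 19 ^ 2 by norm_num, sqClass_mul_sq' (by norm_num) (by norm_num)] at h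
  have g593 : sqClass (593 : ℚ) ∈ Set.range W.xSqClass :=
    sqClass_mem_range_of_eq (b := 1012640008) (x := 593) (y := 775051) (by norm_num) (by norm_num)
  have gT : sqClass (253160002 : ℚ) ∈ Set.range W.xSqClass := by
    refine ⟨W.twoTorsionPoint, ?_⟩
    rw [xSqClass_twoTorsionPoint]
    show sqClass (1012640008 : ℚ) = _
    rw [show (1012640008 : ℚ) = 253160002 * 2 ^ 2 by norm_num, sqClass_mul_sq' (by norm_num) two_ne_zero]
  have g226 : sqClass (226 : ℚ) ∈ Set.range W.xSqClass := by
    have h := mul (by norm_num) (by norm_num) g2 g113; norm_num at h; exact h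
  have g1186 : sqClass (1186 : ℚ) ∈ Set.range W.xSqClass := by
    have h := mul (by norm_num) (by norm_num) g2 g593; norm_num at h; exact h
  have g67009 : sqClass (67009 : ℚ) ∈ Set.range W.xSqClass := by
    have h := mul (by norm_num) (by norm_num) g113 g593; norm_num at h; exact h
  have g134018 : sqClass (134018 : ℚ) ∈ Set.range W.xSqClass := by
    have h := mul (by norm_num) (by norm_num) g2 g67009; norm_num at h; exact h
  set C : Finset ℤ := {1, 2, 113, 226, 593, 1186, 67009, 134018, 253160002} with hC
  have hsub : (↑(C.image fun d : ℤ => sqClass (d : ℚ)) : Set (SqUnits ℚ)) ⊆ Set.range W.xSqClass := by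
    intro c hc
    obtain ⟨d, hd, rfl⟩ := Finset.mem_image.mp (Finset.mem_coe.mp hc)
    simp only [hC, Finset.mem_insert, Finset.mem_singleton] at hd
    rcases hd with rfl | rfl | rfl | rfl | rfl | rfl | rfl | rfl | rfl <;> push_cast
    · exact g0
    · exact g2
    · exact g113
    · exact g226
    · exact g593
    · exact g1186
    · exact g67009
    · exact g134018
    · exact gT
  have hcard : (C.image fun d : ℤ => sqClass (d : ℚ)).card = 9 := by
    rw [Finset.card_image_of_injOn (fun d₁ h₁ d₂ h₂ he =>
      eq_of_sqClass_intCast_eq (squarefree_of_mem h₁) (squarefree_of_mem h₂) he)]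
    rfl
  calc 9 = (↑(C.image fun d : ℤ => sqClass (d : ℚ)) : Set (SqUnits ℚ)).ncard := by rw [Set.ncard_coe_finset, hcard]
    _ ≤ (Set.range W.xSqClass).ncard := Set.ncard_le_ncard hsub hfin
    _ = Nat.card (Set.range W.xSqClass) := (Nat.card_coe_set_eq _).symm

/-! ## §3 `rank E(ℚ) = 7`, `Ш(E/ℚ)[2] = 0`, `t_2(E) = 0`, `corank Sel_{2^∞}(E/ℚ) = 7` -/

/-- `ν(253160002) = ν(506320004) = 4` (`253160002 = 2·113·593·1889`): the bound `ν(D) + ν(2D) − 1` of the descent is `7`. [folklore] -/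
theorem card_primeFactors_n :
    (-253160002 : ℤ).natAbs.primeFactors.card = 4 ∧ (2 * (-253160002 : ℤ)).natAbs.primeFactors.card = 4 := by
  rw [show (-253160002 : ℤ).natAbs = 253160002 from rfl, show (2 * (-253160002 : ℤ)).natAbs = 506320004 from rfl]
  constructor <;> simp [Nat.primeFactors]

/-- **`rank E(ℚ) = 7` for `E : y² = x³ − 253160002x`**, UNCONDITIONALLY. `#α(E(ℚ)) · #ᾱ(E'(ℚ)) = 2^{rank + 2}` (Silverman–Tate,
tree `natCard_range_xSqClass_mul`), so both factors are powers of `2`; `#α ≥ 17` forces `#α ≥ 32`, `#ᾱ ≥ 9` forces `#ᾱ ≥ 16`,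
whence `2^{rank+2} ≥ 2⁹`; and `rank ≤ ν(n) + ν(2n) − 1 = 7` (X.6.1(b) sharpened, tree `XCubeAddDX.mordellWeilRank_le_add`).
[cite: SilvermanTate2015, §3.6 (2^r = #α(Γ)·#ᾱ(Γ̄)/4)] [cite: SilvermanAEC2009, Prop. X.6.1(b)] -/
theorem mordellWeilRank_eq_seven : (⟨0, 0, 0, -253160002, 0⟩ : WeierstrassCurve ℚ).mordellWeilRank = 7 := by
  haveI hE := isElliptic_mk_of_ne_zero (F := ℚ) hab7
  have key := natCard_range_xSqClass_mul (⟨0, ((0 : ℤ) : ℚ), 0, ((-253160002 : ℤ) : ℚ), 0⟩ : WeierstrassCurve ℚ)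
  rw [twoIsogenyCodomain_mk_intCast 0 (-253160002 : ℤ), lit_E', lit_E] at key
  obtain ⟨-, h17⟩ := natCard_range_xSqClass_E_ge
  obtain ⟨-, h9⟩ := natCard_range_xSqClass_E'_ge
  set A := Nat.card (Set.range (⟨0, 0, 0, -253160002, 0⟩ : WeierstrassCurve ℚ).xSqClass) with hA
  set A' := Nat.card (Set.range (⟨0, 0, 0, 1012640008, 0⟩ : WeierstrassCurve ℚ).xSqClass) with hA'
  set r := (⟨0, 0, 0, -253160002, 0⟩ : WeierstrassCurve ℚ).mordellWeilRank with hr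
  -- both factors are powers of two
  obtain ⟨j, -, hj⟩ := (Nat.dvd_prime_pow Nat.prime_two).mp (Dvd.intro _ key : A ∣ 2 ^ (r + 2))
  obtain ⟨j', -, hj'⟩ := (Nat.dvd_prime_pow Nat.prime_two).mp (Dvd.intro_left _ key : A' ∣ 2 ^ (r + 2))
  have h32 : 2 ^ 5 ≤ A := pow_two_le_of_lt hj (by norm_num; omega) (by norm_num)
  have h16 : 2 ^ 4 ≤ A' := pow_two_le_of_lt hj' (by norm_num; omega) (by norm_num)
  have h512 : 2 ^ 9 ≤ 2 ^ (r + 2) := by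
    rw [← key]
    exact le_trans (by norm_num) (Nat.mul_le_mul h32 h16)
  have hge : 9 ≤ r + 2 := (Nat.pow_le_pow_iff_right Nat.one_lt_two).mp h512
  have hle := XCubeAddDX.mordellWeilRank_le_add (D := -253160002) (by norm_num)
  rw [card_primeFactors_n.1, card_primeFactors_n.2, lit_E₀] at hle
  omega

/-- `rank E(ℚ) = ν(D) + ν(2D) − 1` for `D = −253160002`: the descent bound is attained. [cite: SilvermanAEC2009, Prop. X.6.1(b)] -/
theorem mordellWeilRank_eq_bound :
    (⟨0, 0, 0, ((-253160002 : ℤ) : ℚ), 0⟩ : WeierstrassCurve ℚ).mordellWeilRank =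
      (-253160002 : ℤ).natAbs.primeFactors.card + (2 * (-253160002 : ℤ)).natAbs.primeFactors.card - 1 := by
  rw [lit_E₀, mordellWeilRank_eq_seven, card_primeFactors_n.1, card_primeFactors_n.2]

/-- **`Ш(E/ℚ)[2] = 0` for `E : y² = x³ − 253160002x`**, UNCONDITIONALLY (sharp descent, tree
`forall_mem_sha_two_smul_eq_zero_xD_of_rank_eq`, Silverman X.4.7). [cite: SilvermanAEC2009, Prop. X.4.7 and Thm. X.4.2(a)] -/
theorem forall_mem_sha_two_smul_eq_zero :
    ∀ c ∈ (⟨0, 0, 0, -253160002, 0⟩ : WeierstrassCurve ℚ).sha, 2 • c = 0 → c = 0 := by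
  have h := forall_mem_sha_two_smul_eq_zero_xD_of_rank_eq (D := -253160002) (by norm_num) mordellWeilRank_eq_bound
  rwa [lit_E₀] at h

/-- **The door at 2 at rank 7: `rank E(ℚ) = 7` and `t_2(E) = corank_{ℤ_2} Ш(E/ℚ)[2^∞] = 0`** for `E : y² = x³ − 253160002x`.
UNCONDITIONAL. [cite: SilvermanAEC2009, Prop. X.6.1(b) with Prop. X.4.7] [cite: Greenberg1999LNM, §1] -/
theorem door_at_two_rank_seven :
    (⟨0, 0, 0, -253160002, 0⟩ : WeierstrassCurve ℚ).mordellWeilRank = 7 ∧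
      (⟨0, 0, 0, -253160002, 0⟩ : WeierstrassCurve ℚ).shaCorank 2 = 0 := by
  have h := shaCorank_two_xD_of_rank_eq (D := -253160002) (by norm_num) mordellWeilRank_eq_bound
  rw [lit_E₀] at h
  exact ⟨mordellWeilRank_eq_seven, h⟩

/-- **`corank_{ℤ_2} Sel_{2^∞}(E/ℚ) = 7 = rank E(ℚ)`** for `E : y² = x³ − 253160002x`: T's hypothesis in Selmer coordinates,
kernel-certified at rank 7. UNCONDITIONAL. [cite: Greenberg1999LNM, §1 pp. 54–57] -/
theorem selmerCorank_two_eq_seven : (⟨0, 0, 0, -253160002, 0⟩ : WeierstrassCurve ℚ).selmerCorank 2 = 7 := by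
  have h := selmerCorank_two_xD_of_rank_eq (D := -253160002) (by norm_num) mordellWeilRank_eq_bound
  rw [lit_E₀, mordellWeilRank_eq_seven] at h
  exact h

/-- **O holds for `E : y² = x³ − 253160002x`** (rank 7), witness `p₀ = 2`. UNCONDITIONAL. [cite: Greenberg1999LNM, §1] -/
theorem oneFiniteShaComponent_E :
    ∃ (q : ℕ) (_ : Fact q.Prime), (⟨0, 0, 0, -253160002, 0⟩ : WeierstrassCurve ℚ).shaCorank q = 0 :=
  ⟨2, ⟨Nat.prime_two⟩, door_at_two_rank_seven.2⟩

/-- **T at the rank-7 door** (the crux BY NAME): granting T, `t_q(E) = 0` and `corank_{ℤ_q} Sel_{q^∞}(E/ℚ) = 7` at EVERY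
prime `q` — unconditional at `q = 2`, certified for no odd `q`. [cite: Greenberg1999LNM, §1 pp. 54–57] -/
theorem selmerCorank_eq_seven_of_transfer (hT : FiniteShaComponentTransfer) (q : ℕ) [Fact q.Prime] :
    (⟨0, 0, 0, -253160002, 0⟩ : WeierstrassCurve ℚ).shaCorank q = 0 ∧
      (⟨0, 0, 0, -253160002, 0⟩ : WeierstrassCurve ℚ).selmerCorank q = 7 := by
  haveI := isElliptic_E
  haveI : Fact (Nat.Prime 2) := ⟨Nat.prime_two⟩
  have h0 : (⟨0, 0, 0, -253160002, 0⟩ : WeierstrassCurve ℚ).shaCorank q = 0 := hT _ 2 q door_at_two_rank_seven.2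
  refine ⟨h0, ?_⟩
  rw [(⟨0, 0, 0, -253160002, 0⟩ : WeierstrassCurve ℚ).selmerCorank_eq_mordellWeilRank_add_holds q, mordellWeilRank_eq_seven, h0]

/-- **T's hypothesis is kernel-certified at rank 7**: an elliptic `E/ℚ` with `rank = 7`, `corank Sel_{2^∞}(E) = 7`,
`t_2(E) = 0`. UNCONDITIONAL. [cite: Greenberg1999LNM, §1] -/
theorem exists_transfer_hypothesis_rank_seven :
    ∃ W : WeierstrassCurve ℚ, W.IsElliptic ∧ W.mordellWeilRank = 7 ∧ W.selmerCorank 2 = 7 ∧ W.shaCorank 2 = 0 :=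
  ⟨_, isElliptic_E, mordellWeilRank_eq_seven, selmerCorank_two_eq_seven, door_at_two_rank_seven.2⟩

end Summit.BirchSwinnertonDyer.BirchSwinnertonDyer.Theorems.ShaPrimaryTransferKernelRankSeven

end
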